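/-
Fleet lead `ym-wcr-19609-p1` (seat prover-ym-wcr-19609-p1-g2-0), route `WeakCouplingRates`, crux `BulkDominatesColdBoxW`
(stmt-QuantumFields-19609), line `dlr-chessboard` (v8): the Maxwell form, its glue, its mean and its background read the datum ONLY on pinned block edges.
-/
import Summits.QuantumFields.YangMills.Theorems.WeakCouplingRatesBulkDominatesColdBoxWDatumBackground

/-!
# Crux `BulkDominatesColdBoxW`, expansion stubs: datum congruence — `glue`, `formM` (hence the energy clause) depend on the datum `θ` only through its
# values on the PINNED edges of the block

For the assembler (NOTES 01:12Z caveat (iv)): the competitor lemma `exists_datum_coords_energy_eventually` produces coordinates `v` on the enlarged box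
`E`, while the ϑ-pass lemmas (`abs_tiltWD_le_of_mem_goodTD`, …) want a datum defined on all of `ℤ⁴` (zero off `E`, zero on the forest).  Since
`glue a n θ s e` reads `θ e` only for `e ∈ boxEdgesAt a n` with `pin e`, any two data agreeing there have the same glue, the same Maxwell form `formM`, and
hence the same energy clause / mean / background:
* `glue_congr_pinned`, `formM_congr_pinned` (general pinned block);
so the zero-extension of `v` off `E` satisfies the interface's energy clause verbatim.  No new definition; standard axioms.  NOT a claim about the mass gap.
-/

set_option autoImplicit false

noncomputable section

open Finset
open Literature.Probability.LatticeModels Literature.MathematicalPhysics.QuantumLattice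
open Literature.MathematicalPhysics.QuantumFieldTheory Literature.MathematicalPhysics.QuantumFieldTheory.LatticeMaxwell

namespace Summit.QuantumFields.YangMills.Theorems.WeakCouplingRates

section Congr

variable {d : ℕ} {pin : Literature.MathematicalPhysics.QuantumLattice.ZdEdge d → Prop} [DecidablePred pin] {a : Site d} {n : ℕ}

/-- **`glue` reads the datum only on pinned block edges.** -/
theorem glue_congr_pinned {θ θ' : Literature.MathematicalPhysics.QuantumLattice.ZdEdge d → ℝ}
    (h : ∀ e ∈ boxEdgesAt a n, pin e → θ e = θ' e) (s : LatticeMaxwell.Free pin a n → ℝ) :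
    LatticeMaxwell.glue (pin := pin) a n θ s = LatticeMaxwell.glue (pin := pin) a n θ' s := by
  funext e
  by_cases he : e ∈ boxEdgesAt a n
  · by_cases hp : pin e
    · rw [glue_apply_pin _ _ he hp, glue_apply_pin _ _ he hp, h e he hp]
    · have h1 := glue_apply_free (pin := pin) θ s ⟨⟨e, he⟩, hp⟩
      have h2 := glue_apply_free (pin := pin) θ' s ⟨⟨e, he⟩, hp⟩
      simp only at h1 h2
      rw [h1, h2]
  · rw [glue_apply_of_not_mem _ _ he, glue_apply_of_not_mem _ _ he]

/-- **The Maxwell form reads the datum only on pinned block edges**: `M_θ(s) = M_{θ'}(s)` whenever `θ = θ'` there. -/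
theorem formM_congr_pinned {θ θ' : Literature.MathematicalPhysics.QuantumLattice.ZdEdge d → ℝ}
    (h : ∀ e ∈ boxEdgesAt a n, pin e → θ e = θ' e) (s : LatticeMaxwell.Free pin a n → ℝ) :
    formM pin a n θ s = formM pin a n θ' s := by
  unfold formM
  rw [glue_congr_pinned h s]

/-- Consequently the three-colour energy clause of the expansion interfaces is insensitive to the datum off the pinned edges of the enlarged box. -/
theorem sum_formM_congr_pinned {ι : Type*} [Fintype ι] {ϑ ϑ' : ι → Literature.MathematicalPhysics.QuantumLattice.ZdEdge d → ℝ}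
    (h : ∀ c, ∀ e ∈ boxEdgesAt a n, pin e → ϑ c e = ϑ' c e) (s : ι → LatticeMaxwell.Free pin a n → ℝ) :
    ∑ c, formM pin a n (ϑ c) (s c) = ∑ c, formM pin a n (ϑ' c) (s c) :=
  Finset.sum_congr rfl fun c _ => formM_congr_pinned (h c) (s c)

end Congr

end Summit.QuantumFields.YangMills.Theorems.WeakCouplingRates

end
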